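import Summits.BirchSwinnertonDyer.BirchSwinnertonDyer.Theorems.EisensteinPrimesMazurMCOnCellBTwistbackConnectedPartnerDoors
import Summits.BirchSwinnertonDyer.BirchSwinnertonDyer.Theorems.EisensteinPrimesMazurMCOnCellBKatopointByName
import HarnessLib

/-!
# Crux 3 `MazurMCOnCellB` (stmt-BirchSwinnertonDyer-19033), line `twistback` v12 — THE KATO-POINT DOOR INTO THE RIGHT
# DISJUNCT OF THE REGISTERED STUB: at a SPLIT X2b pair, idea-12's `katopoint` readings at ONE admissible partner — the
# image-free exceptional Rubin formula (R) `ExcRubinFormulaAt` and the Perrin-Riou node (PR) `PerrinRiouUpToUnitAt PRRatio`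
# — together with EITHER the `(μ_an, λ_an) = (0, 2)` reading OR the Schneider certificate of the partner, make the pair a
# connected partnered vertex; hence Mazur's main conjecture at the pair (v12 cone)

Successor LEAD seat `cruxlead-stmt-BirchSwinnertonDyer-19033` (gen 0; director-bsd RULING (316)(5)), cell `bsd-eis`,
2026-08-29. `--supports stmt-BirchSwinnertonDyer-19033 --as helper`; a helper under the END-STATE skeleton twistback v12
(sha256 540948e0…, LEAD x2-p1 g15, RESHAPE #35; HELD, not reshaped): its open stub 6⁷ `stub_offSubrow_connectedShaUnitOrPartner`
asks, at every X2b pair off the sub-row, a connected Ш-unit class (left) OR a connected partnered vertex (right); a road is a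
Theorems-side door into a disjunct. LEAD g15's verdict §1/§3 lists «Kato-point (katopoint) partners ↦ right via
`connectedPartner_of_partnerAt`» as a future door; this file lands it. HONEST FRAMING: THEOREMS ONLY (no `def`, no named fact
introduced, no `sorry`); every theorem is CONDITIONAL on the named facts it lists (PUBLISHED: `PublishedInputs` = item -19037;
plus, in the Mazur-MC corollaries, Poitou–Tate ×2 (tree theorems, taken as hypotheses in the door's shape), Hsieh 2014, LZZ
2018, Mazur Cor. 4.1 and Keller–Yin Thm. D (PREPRINT, flag KYD-gap) — the v12 cone) and on PER-PAIR READINGS taken as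
hypotheses at the partner: `r_an(E^{(d_K)}) = 1`, (R) `KatopointDefs.ExcRubinFormulaAt Wd p` (`@[conjecture]`; Büyükboduk 2016
Thm. B / Venerucci Cor. 12.32 in print only for `p ≥ 5`, a PORT at `p = 3`), (PR) `Additive.PerrinRiouUpToUnitAt Kato2004.PRRatio Wd p`
(`@[conjecture]`; Perrin-Riou's conjecture up to a unit — OPEN at a split multiplicative prime with `E[p]` reducible), and
`(μ_an, λ_an)(Wd) = (0, 2)` (§2) or the Schneider certificate of `Wd` (§3); closes no registered stub; no summit statement, no
Mazur main conjecture and no case of BSD is proved for any curve; 0 cells / labels / stubs / tiers move.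

## Why

Road (c) at a SPLIT X2b pair `(W, p)` needs, at a partner `Wd` (a minimal model of `E^{(d_K)}`: X2c ∩ split ∩ `GVPar`, analytic
rank one), the typed exceptional leading term `X2.O9.ExceptionalLeadingTermAt Wd p` — OPEN in print for reducible `E[p]`
(LEAD g15's door p681006 §1 takes it as a reading). Line `katopoint` (idea-12; tree p661268 / p661763 / p662032 / p663485) shows
that residue is NOT primitive: `KatopointByName.exceptionalLeadingTermAt_of_excRubinFormulaAt_of_perrinRiou` derives it, per
pair, from (R) + (PR) + `L′(Wd, 1) ≠ 0` (the latter from `PublishedInputs`: Gross–Zagier I.(7.3) + GZK,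
`KatopointFactorisation.leadingLCoeff_ne_zero_of_publishedInputs`). So the katopoint readings at ONE partner are a door into
6⁷'s right disjunct, in two currencies for the remaining input at `Wd`: the `(0, 2)` reading (λ-minimality; p640749 §3(iii) via
p681006 §1) or the Schneider certificate for THE canonical split height (O9's
`X2.bsdp_of_cellC_of_split_of_gvPar_of_exceptionalLeadingTerm`: Greenberg–Vatsal's MC at the GV twist + Jones + the
certificate ⟹ `BSD(E^{(d_K)}, p)` ⟹ its upper half).

## What

* §1 `exceptionalLeadingTermAt_partner_of_katopoint` — at a minimal model `Wd` of the twist of an X2 pair by an admissible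
  `K` with `r_an = 1`: (R) ∧ (PR) ⟹ `X2.O9.ExceptionalLeadingTermAt Wd p` (`PublishedInputs` for `L′ ≠ 0`).
* §2 `connectedPartner_of_split_of_lamTwo_of_katopoint` — SPLIT X2b pair, ONE admissible `K`, `r_an(E^{(d_K)}) = 1`, and at
  every minimal model of the twist `(μ_an, λ_an) = (0, 2)` ∧ (R) ∧ (PR) ⟹ the right disjunct of 6⁷ (§1 ∘ p681006 §1);
  `mazurMainConjectureAt_of_cellB_of_split_of_lamTwo_of_katopoint` — hence Mazur's MC at the pair (p679233 §1).
* §3 `connectedPartner_of_split_of_schneider_of_excLT` — SPLIT X2b pair, ONE admissible `K`, `r_an(E^{(d_K)}) = 1`, and at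
  every minimal model of the twist the Schneider certificate ∧ the typed exceptional leading term ⟹ the right disjunct (the
  per-pair form of LEAD g9's class-wide `upperPartner_of_schneiderItem_of_excLT`; `PublishedInputs` only);
  `connectedPartner_of_split_of_schneider_of_katopoint` — the same with excLT re-sourced to (R) ∧ (PR) by §1;
  `mazurMainConjectureAt_of_cellB_of_split_of_schneider_of_katopoint` — hence Mazur's MC at the pair.

References: [MazurTateTeitelbaum1986Invent] §II.10; [BurnsKuriharaSano2019] Conj. 2.8 (ii), Thm. 7.3; [Buyukboduk2016IMRN]
Thm. B; [SteinWuthrich2013] Thm. 6.1, §4.2; [GreenbergVatsal2000] Thm. (1.3), §3 Thm. (3.11); [Wuthrich2014] Thm. 16;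
[Schneider1985] §1; [KellerYin2024] Thm. D; [GrossZagier1986] Thm. I.(7.3); tree: p640749, p661763, p663485, p679233, p681006,
`X2/ClassClosureO9.lean` §5.
-/

set_option autoImplicit false

-- `Summit.BirchSwinnertonDyer.BirchSwinnertonDyer.…`: the summit and its single sub-problem share a name.
set_option linter.dupNamespace false

noncomputable section

open scoped Classical MatrixGroups ModularForm

open CongruenceSubgroup WeierstrassCurve NumberField IsDedekindDomain Field
  Literature.NumberTheory.EllipticCurves
  Literature.NumberTheory.GaloisRepresentations
  Literature.NumberTheory.EllipticCurves.ModularForms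
  Literature.NumberTheory.QuadraticFields
  Literature.NumberTheory.EllipticCurves.Rank1Residual
  Literature.NumberTheory.EllipticCurves.Rank1Residual.Typed
  Literature.NumberTheory.EllipticCurves.Wuthrich2014
  Literature.NumberTheory.EllipticCurves.SteinWuthrich2013
  Literature.NumberTheory.EllipticCurves.Disegni2020
  Literature.NumberTheory.EllipticCurves.KellerYin2024
  Literature.NumberTheory.GaloisCohomology
  Summit.BirchSwinnertonDyer.Rank1Residual
  Summit.BirchSwinnertonDyer.Rank1Residual.X2
  Summit.BirchSwinnertonDyer.BirchSwinnertonDyer.Theses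
  Summit.BirchSwinnertonDyer.BirchSwinnertonDyer.Theorems.EisensteinPrimesMazurMCOnCellBTwistbackTwoStepDefs
  Summit.BirchSwinnertonDyer.BirchSwinnertonDyer.Theorems.EisensteinPrimesMazurMCOnCellBTwistbackConnectedPartnerZigzag
  Summit.BirchSwinnertonDyer.BirchSwinnertonDyer.Theorems.EisensteinPrimesMazurMCOnCellBTwistbackConnectedPartnerDoors
  Summit.BirchSwinnertonDyer.BirchSwinnertonDyer.Theorems.EisensteinPrimesMazurMCOnCellBKatopointDefs
  Summit.BirchSwinnertonDyer.BirchSwinnertonDyer.Theorems.EisensteinPrimesMazurMCOnCellBKatopointFactorisation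
  Summit.BirchSwinnertonDyer.BirchSwinnertonDyer.Theorems.EisensteinPrimesMazurMCOnCellBKatopointByName

namespace Summit.BirchSwinnertonDyer.BirchSwinnertonDyer.Theorems.EisensteinPrimesMazurMCOnCellBTwistbackKatopointDoor

/-! ## §1. The exceptional leading term at a partner from the katopoint readings -/

/-- **(R) ∧ (PR) at a minimal model of the twist ⟹ the typed exceptional leading term there.** Data: an X2 pair `(W, p)`
(`ClassX2 W p`: `p ≠ 2`, `E[p]` reducible, `p` multiplicative), `K` imaginary quadratic with `p` split in `K`, the reading
`ord_{s=1} L(E^{(d_K)}, s) = 1`, a globally minimal model `Wd` of `E^{(d_K)}`, and at `Wd` the katopoint readings (R)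
`ExcRubinFormulaAt Wd p` and (PR) `Additive.PerrinRiouUpToUnitAt Kato2004.PRRatio Wd p`. Then `X2.O9.ExceptionalLeadingTermAt Wd p`:
`r_an(Wd) = 1` by `analyticRank_smul`, `L′(Wd, 1) ≠ 0` from `PublishedInputs` (Gross–Zagier I.(7.3) + GZK,
`leadingLCoeff_ne_zero_of_publishedInputs`), then `KatopointByName.exceptionalLeadingTermAt_of_excRubinFormulaAt_of_perrinRiou`.
CONDITIONAL on `PublishedInputs` and on (R), (PR) — both `@[conjecture]` nodes, OPEN at a split multiplicative prime with
`E[p]` reducible; nothing about them is proved. [cite: MazurTateTeitelbaum1986Invent, §II.10 (hypothesis)]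
[cite: BurnsKuriharaSano2019, Conj. 2.8 (ii) (p. 10) (hypothesis)] [cite: GrossZagier1986, Thm. I.(7.3) 2)] -/
theorem exceptionalLeadingTermAt_partner_of_katopoint (hP : EisensteinPrimes.PublishedInputs)
    (W : WeierstrassCurve ℚ) [W.IsElliptic] [W.IsGloballyMinimal] (p : ℕ) [Fact p.Prime] (hX : ClassX2 W p)
    (K : Type) [Field K] [NumberField K]
    (hr1 : (W.quadraticTwist (NumberField.discr K : ℚ)).analyticRank = 1)
    (Wd : WeierstrassCurve ℚ) [Wd.IsElliptic] [Wd.IsGloballyMinimal]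
    (hWd : ∃ C : VariableChange ℚ, C • Wd = W.quadraticTwist (NumberField.discr K : ℚ))
    (hRub : ExcRubinFormulaAt Wd p) (hPR : Additive.PerrinRiouUpToUnitAt Kato2004.PRRatio Wd p) :
    X2.O9.ExceptionalLeadingTermAt Wd p := by
  have hp2 : p ≠ 2 := hX.1
  obtain ⟨C, hC⟩ := hWd
  have hrd : Wd.analyticRank = 1 := by
    have h := congrArg WeierstrassCurve.analyticRank hC
    rw [analyticRank_smul] at h
    rw [h, hr1]
  exact exceptionalLeadingTermAt_of_excRubinFormulaAt_of_perrinRiou Wd p hrd hp2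
    (leadingLCoeff_ne_zero_of_publishedInputs hP Wd hrd) hRub hPR

/-! ## §2. Katopoint readings + the `(0, 2)` reading at ONE split partner ⟹ the right disjunct of 6⁷ -/

/-- **KATO-POINT ROAD AT A SPLIT X2b PAIR, λ-currency ⟹ the right disjunct of the v12 stub.** Data: `X2.CellB W p` with `p`
SPLIT for `W`; `K` imaginary quadratic, Heegner for `N_W` and `p`, `d_K` odd `< −4`; the reading `ord_{s=1} L(E^{(d_K)}, s) = 1`;
and at every globally minimal model `Wd` of `E^{(d_K)}` the readings `X2.AnalyticMuLE Wd p 0`, `X2.AnalyticLambdaEq Wd p 2`, (R)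
`ExcRubinFormulaAt Wd p` and (PR) `Additive.PerrinRiouUpToUnitAt Kato2004.PRRatio Wd p`. §1 turns (R) ∧ (PR) into
`X2.O9.ExceptionalLeadingTermAt Wd p`, and LEAD g15's road-(c) door p681006 §1 `connectedPartner_of_split_of_lamTwo_of_excLT`
concludes (upper half at `Wd` by p640749 §3(iii), then `connectedPartner_of_partnerAt`, the empty zig-zag). CONDITIONAL on
`PublishedInputs` and on the per-pair readings; (R)/(PR) are OPEN conjecture nodes; nothing class-wide is closed.
[cite: MazurTateTeitelbaum1986Invent, §II.10 (hypothesis)] [cite: BurnsKuriharaSano2019, Conj. 2.8 (ii) (p. 10) (hypothesis)]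
[cite: SteinWuthrich2013, Thm. 6.1 (p. 20), §4.2] [cite: GreenbergVatsal2000, Thm. (1.3) with pp. 14–15] -/
theorem connectedPartner_of_split_of_lamTwo_of_katopoint (hP : EisensteinPrimes.PublishedInputs)
    (W : WeierstrassCurve ℚ) [W.IsElliptic] [W.IsGloballyMinimal] (p : ℕ) [Fact p.Prime]
    (hc : X2.CellB W p) (hsplit : W.HasSplitMultiplicativeReductionAtPrime p)
    (K : Type) [Field K] [NumberField K] (hK : IsImaginaryQuadratic K)
    (hHN : SatisfiesHeegnerHypothesis (W.conductorNorm ℤ) K) (hHp : SatisfiesHeegnerHypothesis p K)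
    (hodd : Odd (NumberField.discr K)) (hlt : NumberField.discr K < -4)
    (hr1 : (W.quadraticTwist (NumberField.discr K : ℚ)).analyticRank = 1)
    (hcert : ∀ (Wd : WeierstrassCurve ℚ) [Wd.IsElliptic] [Wd.IsGloballyMinimal],
      (∃ C : VariableChange ℚ, C • Wd = W.quadraticTwist (NumberField.discr K : ℚ)) →
      X2.AnalyticMuLE Wd p 0 ∧ X2.AnalyticLambdaEq Wd p 2 ∧
        ExcRubinFormulaAt Wd p ∧ Additive.PerrinRiouUpToUnitAt Kato2004.PRRatio Wd p) :
    ∃ (W₁ : WeierstrassCurve ℚ) (_ : W₁.IsElliptic) (_ : W₁.IsGloballyMinimal)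
      (U : WeierstrassCurve ℚ) (_ : U.IsElliptic) (_ : U.IsGloballyMinimal)
      (W₀ : WeierstrassCurve ℚ) (_ : W₀.IsElliptic) (_ : W₀.IsGloballyMinimal),
      IsIsogenous W W₁ ∧
      Relation.ReflTransGen (fun A B : WeierstrassCurve ℚ ↦ TwoStepAt p A B ∨
        (TwoStepAt p B A ∧ ∃ (_ : B.IsElliptic) (_ : B.IsGloballyMinimal), X2.CellB B p)) W₁ U ∧
      IsIsogenous U W₀ ∧
      ∃ (K : Type) (_ : Field K) (_ : NumberField K), IsImaginaryQuadratic K ∧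
        SatisfiesHeegnerHypothesis (W₀.conductorNorm ℤ) K ∧ SatisfiesHeegnerHypothesis p K ∧
        Odd (NumberField.discr K) ∧ NumberField.discr K < -4 ∧
        (W₀.quadraticTwist (NumberField.discr K : ℚ)).analyticRank = 1 ∧
        ∀ (Wd : WeierstrassCurve ℚ) [Wd.IsElliptic] [Wd.IsGloballyMinimal],
          (∃ C : VariableChange ℚ, C • Wd = W₀.quadraticTwist (NumberField.discr K : ℚ)) →
          MissingUpperBoundAt Wd p := by
  refine connectedPartner_of_split_of_lamTwo_of_excLT hP W p hc hsplit K hK hHN hHp hodd hlt hr1 ?_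
  intro Wd _ _ hWd
  obtain ⟨hμ, hlam, hRub, hPR⟩ := hcert Wd hWd
  exact ⟨hμ, hlam, exceptionalLeadingTermAt_partner_of_katopoint hP W p hc.2.1 K hr1 Wd hWd hRub hPR⟩

/-- **Mazur's main conjecture at a SPLIT X2b pair from the katopoint readings + `(0, 2)` at ONE admissible partner** — §2 then
LEAD g15's right-disjunct door p679233 §1 `mazurMainConjectureAt_of_cellB_of_connectedPartner`. Named facts BY NAME:
`PublishedInputs`, Poitou–Tate ×2 (hypotheses; tree theorems), Hsieh, LZZ, Mazur Cor. 4.1, Keller–Yin Thm. D (PRE) — the v12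
cone. CONDITIONAL; (R)/(PR) are OPEN conjecture nodes at a split multiplicative prime with `E[p]` reducible, so nothing is
closed class-wide and no cell moves by this theorem alone. [claim: KellerYin2024, status: under-review]
[cite: KellerYin2024, Thm. D = Thm. 5.1.3] [cite: MazurTateTeitelbaum1986Invent, §II.10 (hypothesis)]
[cite: BurnsKuriharaSano2019, Conj. 2.8 (ii) (p. 10) (hypothesis)] [cite: Miller2011LMS, Def. 1.1] -/
theorem mazurMainConjectureAt_of_cellB_of_split_of_lamTwo_of_katopoint (hP : EisensteinPrimes.PublishedInputs)
    (hPT : ∀ (K : Type) [Field K] [NumberField K], poitouTate_selmerStructure_duality K)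
    (hPT2 : ∀ (K : Type) [Field K] [NumberField K], poitouTate_sha_tateDual K)
    (hH : hsieh2014_exists_anticyclotomicPAdicLFunction)
    (hF : LiuZhangZhang2018.thm151_thm153_modularCurve_heegnerVector) (hMaz : mazur_not_dvd_maninConstant_of_odd)
    (hD : KellerYin2024.thmD_imcMult_exists_isBDPLFunction_isTorsion_charIdeal_eq_OPEN)
    (W : WeierstrassCurve ℚ) [W.IsElliptic] [W.IsGloballyMinimal] (p : ℕ) [Fact p.Prime]
    (hc : X2.CellB W p) (hsplit : W.HasSplitMultiplicativeReductionAtPrime p)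
    (K : Type) [Field K] [NumberField K] (hK : IsImaginaryQuadratic K)
    (hHN : SatisfiesHeegnerHypothesis (W.conductorNorm ℤ) K) (hHp : SatisfiesHeegnerHypothesis p K)
    (hodd : Odd (NumberField.discr K)) (hlt : NumberField.discr K < -4)
    (hr1 : (W.quadraticTwist (NumberField.discr K : ℚ)).analyticRank = 1)
    (hcert : ∀ (Wd : WeierstrassCurve ℚ) [Wd.IsElliptic] [Wd.IsGloballyMinimal],
      (∃ C : VariableChange ℚ, C • Wd = W.quadraticTwist (NumberField.discr K : ℚ)) →
      X2.AnalyticMuLE Wd p 0 ∧ X2.AnalyticLambdaEq Wd p 2 ∧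
        ExcRubinFormulaAt Wd p ∧ Additive.PerrinRiouUpToUnitAt Kato2004.PRRatio Wd p) :
    X2.MazurMainConjectureAt W p :=
  mazurMainConjectureAt_of_cellB_of_connectedPartner hP hPT hPT2 hH hF hMaz hD W p hc
    (connectedPartner_of_split_of_lamTwo_of_katopoint hP W p hc hsplit K hK hHN hHp hodd hlt hr1 hcert)

/-! ## §3. Katopoint readings + the Schneider certificate at ONE split partner ⟹ the right disjunct of 6⁷ -/

/-- **ROAD (c) AT A SPLIT X2b PAIR, Schneider-currency ⟹ the right disjunct of the v12 stub** (the per-pair form of LEAD g9's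
class-wide `upperPartner_of_schneiderItem_of_excLT`). Data: `X2.CellB W p` with `p` SPLIT for `W`; `K` imaginary quadratic,
Heegner for `N_W` and `p`, `d_K` odd `< −4`; the reading `ord_{s=1} L(E^{(d_K)}, s) = 1`; and at every globally minimal model
`Wd` of `E^{(d_K)}` the Schneider certificate for THE canonical split height (`∀ Dq Dh, IsSplitMultCanonical Dh Dq →
SchneiderConjecture Dh`) and the typed exceptional leading term `X2.O9.ExceptionalLeadingTermAt Wd p`. Each `Wd` is X2
(`X2.classX2_twist`), SPLIT at `p` (`X2.hasSplitMultiplicativeReductionAtPrime_iff_of_smul_eq_quadraticTwist`), of analytic rank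
one (`analyticRank_smul`) and GV (the parity FLIPS under the odd character `ε_K` unramified at `p`: `gvPar_of_not_gvPar_of_twist`,
`not_dvd_discr_of_split`), so O9's `X2.bsdp_of_cellC_of_split_of_gvPar_of_exceptionalLeadingTerm` (Greenberg–Vatsal Thm. (1.3),
Wuthrich Thm. 16, Jones Thm. 6.1, the canonical height, Gross–Zagier, GZK, modular parametrisation — all projections of
`PublishedInputs`) gives `BSDp Wd p`, whose upper half is `MissingUpperBoundAt Wd p` (`missingPPartAt_of_bsdp`, `Ш(Wd)` finite
by GZK); `connectedPartner_of_partnerAt` packages the partner AT `W` (empty zig-zag). CONDITIONAL on `PublishedInputs` and on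
the two per-pair inputs (Schneider's conjecture per pair; the exceptional leading term, OPEN in print for reducible `E[p]`).
[cite: Schneider1985, §1 (hypothesis)] [cite: MazurTateTeitelbaum1986Invent, §II.10 (hypothesis)]
[cite: GreenbergVatsal2000, Thm. (1.3) with pp. 1, 14–15] [cite: Wuthrich2014, Thm. 16 (p. 397)]
[cite: SteinWuthrich2013, Thm. 6.1 (p. 20) and §4.2] -/
theorem connectedPartner_of_split_of_schneider_of_excLT (hP : EisensteinPrimes.PublishedInputs)
    (W : WeierstrassCurve ℚ) [W.IsElliptic] [W.IsGloballyMinimal] (p : ℕ) [Fact p.Prime]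
    (hc : X2.CellB W p) (hsplit : W.HasSplitMultiplicativeReductionAtPrime p)
    (K : Type) [Field K] [NumberField K] (hK : IsImaginaryQuadratic K)
    (hHN : SatisfiesHeegnerHypothesis (W.conductorNorm ℤ) K) (hHp : SatisfiesHeegnerHypothesis p K)
    (hodd : Odd (NumberField.discr K)) (hlt : NumberField.discr K < -4)
    (hr1 : (W.quadraticTwist (NumberField.discr K : ℚ)).analyticRank = 1)
    (hcert : ∀ (Wd : WeierstrassCurve ℚ) [Wd.IsElliptic] [Wd.IsGloballyMinimal],
      (∃ C : VariableChange ℚ, C • Wd = W.quadraticTwist (NumberField.discr K : ℚ)) →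
      (∀ (Dq : TateParameterData Wd p) (Dh : PAdicHeightData Wd p),
          IsSplitMultCanonical Dh Dq → SchneiderConjecture Dh) ∧
        X2.O9.ExceptionalLeadingTermAt Wd p) :
    ∃ (W₁ : WeierstrassCurve ℚ) (_ : W₁.IsElliptic) (_ : W₁.IsGloballyMinimal)
      (U : WeierstrassCurve ℚ) (_ : U.IsElliptic) (_ : U.IsGloballyMinimal)
      (W₀ : WeierstrassCurve ℚ) (_ : W₀.IsElliptic) (_ : W₀.IsGloballyMinimal),
      IsIsogenous W W₁ ∧
      Relation.ReflTransGen (fun A B : WeierstrassCurve ℚ ↦ TwoStepAt p A B ∨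
        (TwoStepAt p B A ∧ ∃ (_ : B.IsElliptic) (_ : B.IsGloballyMinimal), X2.CellB B p)) W₁ U ∧
      IsIsogenous U W₀ ∧
      ∃ (K : Type) (_ : Field K) (_ : NumberField K), IsImaginaryQuadratic K ∧
        SatisfiesHeegnerHypothesis (W₀.conductorNorm ℤ) K ∧ SatisfiesHeegnerHypothesis p K ∧
        Odd (NumberField.discr K) ∧ NumberField.discr K < -4 ∧
        (W₀.quadraticTwist (NumberField.discr K : ℚ)).analyticRank = 1 ∧
        ∀ (Wd : WeierstrassCurve ℚ) [Wd.IsElliptic] [Wd.IsGloballyMinimal],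
          (∃ C : VariableChange ℚ, C • Wd = W₀.quadraticTwist (NumberField.discr K : ℚ)) →
          MissingUpperBoundAt Wd p := by
  have hp : p.Prime := Fact.out
  have hpar := hP.2.2.2.2.1
  have hGZ := hP.2.2.2.2.2.2.2.1
  have hGZK := hP.2.2.2.2.2.2.2.2.2.2.1
  have hGV := hP.2.2.2.2.2.2.2.2.2.2.2.2.2.1
  have hWu := hP.2.2.2.2.2.2.2.2.2.2.2.2.2.2.1
  have hJs := hP.2.2.2.2.2.2.2.2.2.2.2.2.2.2.2.1
  have hHs := hP.2.2.2.2.2.2.2.2.2.2.2.2.2.2.2.2.2.1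
  obtain ⟨_, hX, hnot⟩ := hc
  obtain ⟨hp2, hred, hmult⟩ := hX
  refine connectedPartner_of_partnerAt W ⟨K, inferInstance, inferInstance, hK, hHN, hHp, hodd, hlt, hr1, ?_⟩
  intro Wd _ _ hWd
  obtain ⟨C, hC⟩ := hWd
  -- the partner: class X2, Greenberg–Vatsal parity (flipped), SPLIT at `p`, analytic rank one
  have hdneg : NumberField.discr K < 0 := IsImaginaryQuadratic.discr_neg hK
  have hpd : ¬ (p : ℤ) ∣ NumberField.discr K := not_dvd_discr_of_split hK hp hp2 hHp
  have hXd : ClassX2 Wd p := X2.classX2_twist W p ⟨hp2, hred, hmult⟩ K hK hHp Wd ⟨C, hC⟩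
  have hgv : GVPar Wd p :=
    gvPar_of_not_gvPar_of_twist (W := W) (p := p) hp2 hred hnot hdneg hpd Wd C (by simpa using hC)
  have hsd : Wd.HasSplitMultiplicativeReductionAtPrime p :=
    (X2.hasSplitMultiplicativeReductionAtPrime_iff_of_smul_eq_quadraticTwist W Wd hK p hp2 hmult hHp hC).mpr hsplit
  have hrd : Wd.analyticRank = 1 := by
    have h := congrArg WeierstrassCurve.analyticRank hC
    rw [analyticRank_smul] at h
    rw [h, hr1]
  have hcS : X2.CellCSplitGV Wd p := ⟨⟨hrd, hXd⟩, hsd, hgv⟩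
  obtain ⟨hSch, hExc⟩ := hcert Wd ⟨C, hC⟩
  -- `BSD(E^{(d_K)}, p)` from Greenberg–Vatsal's MC + the exceptional leading term + the Schneider certificate
  have hB : BSDp Wd p :=
    X2.bsdp_of_cellC_of_split_of_gvPar_of_exceptionalLeadingTerm Wd p hGV hWu hJs hHs hGZ hGZK hpar hcS hExc hSch
  haveI : Finite Wd.sha := (hGZK Wd (le_of_eq hrd)).2
  exact (lower_and_upper_of_missingPPartAt Wd p (missingPPartAt_of_bsdp Wd p hB)).2

/-- **KATO-POINT ROAD AT A SPLIT X2b PAIR, Schneider-currency ⟹ the right disjunct of the v12 stub.** As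
`connectedPartner_of_split_of_schneider_of_excLT`, with the typed exceptional leading term at each minimal model of the twist
RE-SOURCED to the katopoint readings (R) `ExcRubinFormulaAt Wd p` ∧ (PR) `Additive.PerrinRiouUpToUnitAt Kato2004.PRRatio Wd p` by
§1. Per pair the remaining inputs at ONE partner are: the Schneider certificate (one `p`-adic regulator non-vanishing), (R)
(a PORT of a printed image-free identity at `p = 3`) and (PR) (one `p`-adic number `ℒ`: Perrin-Riou up to a unit). CONDITIONAL
on `PublishedInputs` and on those readings; (R)/(PR) are OPEN conjecture nodes; nothing class-wide is closed.
[cite: Schneider1985, §1 (hypothesis)] [cite: MazurTateTeitelbaum1986Invent, §II.10 (hypothesis)]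
[cite: BurnsKuriharaSano2019, Conj. 2.8 (ii) (p. 10) (hypothesis)] [cite: GreenbergVatsal2000, Thm. (1.3) with pp. 1, 14–15] -/
theorem connectedPartner_of_split_of_schneider_of_katopoint (hP : EisensteinPrimes.PublishedInputs)
    (W : WeierstrassCurve ℚ) [W.IsElliptic] [W.IsGloballyMinimal] (p : ℕ) [Fact p.Prime]
    (hc : X2.CellB W p) (hsplit : W.HasSplitMultiplicativeReductionAtPrime p)
    (K : Type) [Field K] [NumberField K] (hK : IsImaginaryQuadratic K)
    (hHN : SatisfiesHeegnerHypothesis (W.conductorNorm ℤ) K) (hHp : SatisfiesHeegnerHypothesis p K)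
    (hodd : Odd (NumberField.discr K)) (hlt : NumberField.discr K < -4)
    (hr1 : (W.quadraticTwist (NumberField.discr K : ℚ)).analyticRank = 1)
    (hcert : ∀ (Wd : WeierstrassCurve ℚ) [Wd.IsElliptic] [Wd.IsGloballyMinimal],
      (∃ C : VariableChange ℚ, C • Wd = W.quadraticTwist (NumberField.discr K : ℚ)) →
      (∀ (Dq : TateParameterData Wd p) (Dh : PAdicHeightData Wd p),
          IsSplitMultCanonical Dh Dq → SchneiderConjecture Dh) ∧
        ExcRubinFormulaAt Wd p ∧ Additive.PerrinRiouUpToUnitAt Kato2004.PRRatio Wd p) :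
    ∃ (W₁ : WeierstrassCurve ℚ) (_ : W₁.IsElliptic) (_ : W₁.IsGloballyMinimal)
      (U : WeierstrassCurve ℚ) (_ : U.IsElliptic) (_ : U.IsGloballyMinimal)
      (W₀ : WeierstrassCurve ℚ) (_ : W₀.IsElliptic) (_ : W₀.IsGloballyMinimal),
      IsIsogenous W W₁ ∧
      Relation.ReflTransGen (fun A B : WeierstrassCurve ℚ ↦ TwoStepAt p A B ∨
        (TwoStepAt p B A ∧ ∃ (_ : B.IsElliptic) (_ : B.IsGloballyMinimal), X2.CellB B p)) W₁ U ∧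
      IsIsogenous U W₀ ∧
      ∃ (K : Type) (_ : Field K) (_ : NumberField K), IsImaginaryQuadratic K ∧
        SatisfiesHeegnerHypothesis (W₀.conductorNorm ℤ) K ∧ SatisfiesHeegnerHypothesis p K ∧
        Odd (NumberField.discr K) ∧ NumberField.discr K < -4 ∧
        (W₀.quadraticTwist (NumberField.discr K : ℚ)).analyticRank = 1 ∧
        ∀ (Wd : WeierstrassCurve ℚ) [Wd.IsElliptic] [Wd.IsGloballyMinimal],
          (∃ C : VariableChange ℚ, C • Wd = W₀.quadraticTwist (NumberField.discr K : ℚ)) →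
          MissingUpperBoundAt Wd p := by
  refine connectedPartner_of_split_of_schneider_of_excLT hP W p hc hsplit K hK hHN hHp hodd hlt hr1 ?_
  intro Wd _ _ hWd
  obtain ⟨hSch, hRub, hPR⟩ := hcert Wd hWd
  exact ⟨hSch, exceptionalLeadingTermAt_partner_of_katopoint hP W p hc.2.1 K hr1 Wd hWd hRub hPR⟩

/-- **Mazur's main conjecture at a SPLIT X2b pair from the katopoint readings + the Schneider certificate at ONE admissible
partner** — `connectedPartner_of_split_of_schneider_of_katopoint` then p679233 §1
`mazurMainConjectureAt_of_cellB_of_connectedPartner`. Named facts BY NAME: `PublishedInputs`, Poitou–Tate ×2 (hypotheses; tree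
theorems), Hsieh, LZZ, Mazur Cor. 4.1, Keller–Yin Thm. D (PRE) — the v12 cone. CONDITIONAL; Schneider per pair and (R)/(PR) are
OPEN at a split multiplicative prime with `E[p]` reducible; nothing is closed class-wide and no cell moves by this theorem alone.
[claim: KellerYin2024, status: under-review] [cite: KellerYin2024, Thm. D = Thm. 5.1.3] [cite: Schneider1985, §1 (hypothesis)]
[cite: MazurTateTeitelbaum1986Invent, §II.10 (hypothesis)] [cite: BurnsKuriharaSano2019, Conj. 2.8 (ii) (p. 10) (hypothesis)]
[cite: Miller2011LMS, Def. 1.1] -/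
theorem mazurMainConjectureAt_of_cellB_of_split_of_schneider_of_katopoint (hP : EisensteinPrimes.PublishedInputs)
    (hPT : ∀ (K : Type) [Field K] [NumberField K], poitouTate_selmerStructure_duality K)
    (hPT2 : ∀ (K : Type) [Field K] [NumberField K], poitouTate_sha_tateDual K)
    (hH : hsieh2014_exists_anticyclotomicPAdicLFunction)
    (hF : LiuZhangZhang2018.thm151_thm153_modularCurve_heegnerVector) (hMaz : mazur_not_dvd_maninConstant_of_odd)
    (hD : KellerYin2024.thmD_imcMult_exists_isBDPLFunction_isTorsion_charIdeal_eq_OPEN)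
    (W : WeierstrassCurve ℚ) [W.IsElliptic] [W.IsGloballyMinimal] (p : ℕ) [Fact p.Prime]
    (hc : X2.CellB W p) (hsplit : W.HasSplitMultiplicativeReductionAtPrime p)
    (K : Type) [Field K] [NumberField K] (hK : IsImaginaryQuadratic K)
    (hHN : SatisfiesHeegnerHypothesis (W.conductorNorm ℤ) K) (hHp : SatisfiesHeegnerHypothesis p K)
    (hodd : Odd (NumberField.discr K)) (hlt : NumberField.discr K < -4)
    (hr1 : (W.quadraticTwist (NumberField.discr K : ℚ)).analyticRank = 1)
    (hcert : ∀ (Wd : WeierstrassCurve ℚ) [Wd.IsElliptic] [Wd.IsGloballyMinimal],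
      (∃ C : VariableChange ℚ, C • Wd = W.quadraticTwist (NumberField.discr K : ℚ)) →
      (∀ (Dq : TateParameterData Wd p) (Dh : PAdicHeightData Wd p),
          IsSplitMultCanonical Dh Dq → SchneiderConjecture Dh) ∧
        ExcRubinFormulaAt Wd p ∧ Additive.PerrinRiouUpToUnitAt Kato2004.PRRatio Wd p) :
    X2.MazurMainConjectureAt W p :=
  mazurMainConjectureAt_of_cellB_of_connectedPartner hP hPT hPT2 hH hF hMaz hD W p hc
    (connectedPartner_of_split_of_schneider_of_katopoint hP W p hc hsplit K hK hHN hHp hodd hlt hr1 hcert)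

end Summit.BirchSwinnertonDyer.BirchSwinnertonDyer.Theorems.EisensteinPrimesMazurMCOnCellBTwistbackKatopointDoor

end
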